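import Literature.Probability.RandomPlanarGeometry.SAWSubBallistic
import HarnessLib

/-!
# The three-crossings lemma: an irreducible bridge of span `A` has at least `3A - 2` steps

Topic `Literature/Probability/RandomPlanarGeometry` (continues `SAWBridges.lean` / `SAWSubBallistic.lean`:
`Zd.IsBridge`, `Zd.IsRenewalTime`, `Zd.irreducibleBridges`).

Source: N. Madras, G. Slade, *The Self-Avoiding Walk* (1993; 2013 reprint pagination), §4.2, p. 94, remark after
Theorem 4.2.4 (held scan `book:madras1993-self-avoiding-walk` p0109:L47–50): "an irreducible bridge of span
`L ≥ 2` must have at least `3L` steps" — STATED WITHOUT PROOF there (it feeds (4.2.21)–(4.2.22),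
`A_z(L) ≤ Σ_{N ≥ 3L} b_N z^N`). PROVED HERE in the form `3A ≤ k + 2` for EVERY irreducible `k`-step bridge of
span `A` (all `A ≥ 1`, every dimension), which is what the lane's «PULL-GAP» route (R35) consumes; the sharper
printed `3A ≤ k` for `A ≥ 2` additionally uses self-avoidance (two transverse steps) and is not needed downstream.

## The argument (every `d ≥ 1`, vertex-function walks on `ℤ^d`)

Heights `h(t) = ω₁(t)` move by at most one per step. The level gap `{g, g+1}`, `0 ≤ g ≤ A-1`, is CROSSED at time
`t < k` if `{h(t), h(t+1)} = {g, g+1}`; distinct gaps are crossed at distinct times, so `k ≥ Σ_g #crossings(g)`.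
Gap `0` is crossed at time `0`. For an INTERNAL gap (`1 ≤ g ≤ A-1`) let `t₁` be the first up-crossing; if the
walk never returned to height `≤ g` after `t₁`, then `t₁ ∈ [1, k-1]` would be a renewal time (`ω[0,t₁]` stays at
heights `≤ g = h(t₁)`, `ω[t₁,k]` at heights `> g`) — excluded by irreducibility; so there is a down-crossing
`t_d > t₁`, and after it a further up-crossing `t₂ > t_d` (the walk ends at height `A ≥ g+1`): three crossings.
Hence `k ≥ 1 + 3(A-1)`.

## Contents (namespace `Literature.Probability.RandomPlanarGeometry.SAW.Zd`; theorems only, no facts, no defs)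
private helpers `exists_upcross`, `exists_downcross` (discrete intermediate-value steps for `±1`-Lipschitz integer
sequences), **`three_mul_span_le`** (`3 · span ≤ k + 2`, `ℕ` form with `Int.toNat`), `three_mul_span_le_int` (`ℤ` form).
Lane «pcv-sawmu» route R35 «PULL-GAP», item R35.1 (typed stub `stub_R35_1_three_mul_span_le`, a-idea-1 g8;
guard row P-R35-1 TRUE on the ℤ² census, 167 cells). Tree-twin search: stems `three_mul_span`, `upcross`,
`crossing` over `Literature/Probability/RandomPlanarGeometry` → no statement (only `SAWWordBridgesCrossings.lean`,
word-model parity bookkeeping for P–T bridges, different objects). No twin.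
-/

noncomputable section

open Finset Literature.Probability.LatticeModels Literature.Probability.Percolation SimpleGraph
open scoped BigOperators

namespace Literature.Probability.RandomPlanarGeometry.SAW.Zd

/-! ### Discrete intermediate-value steps -/

/-- **First up-crossing.** If an integer sequence moves by at most `1` per step on `[0,k)`, starts `≤ g` at time
`t₀` and is `≥ g+1` at a later time `s₁ ≤ k`, then it crosses the gap `{g, g+1}` upward at some time
`t ∈ [t₀, s₁)`, having stayed `≤ g` on `[t₀, t]`. [folklore] -/
private theorem exists_upcross {h : ℕ → ℤ} {k : ℕ} (hstep : ∀ t, t < k → |h (t + 1) - h t| ≤ 1)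
    {t₀ s₁ : ℕ} {g : ℤ} (h01 : t₀ ≤ s₁) (hs₁ : s₁ ≤ k) (hlo : h t₀ ≤ g) (hhi : g + 1 ≤ h s₁) :
    ∃ t, t₀ ≤ t ∧ t < s₁ ∧ h t = g ∧ h (t + 1) = g + 1 ∧ ∀ u, t₀ ≤ u → u ≤ t → h u ≤ g := by
  classical
  have hex : ∃ s, t₀ ≤ s ∧ s ≤ s₁ ∧ g + 1 ≤ h s := ⟨s₁, h01, le_rfl, hhi⟩
  obtain ⟨s, ⟨hs0, hss₁, hsg⟩, hmin⟩ : ∃ s, (t₀ ≤ s ∧ s ≤ s₁ ∧ g + 1 ≤ h s) ∧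
      ∀ u, u < s → ¬ (t₀ ≤ u ∧ u ≤ s₁ ∧ g + 1 ≤ h u) :=
    ⟨Nat.find hex, Nat.find_spec hex, fun u hu => Nat.find_min hex hu⟩
  have hst₀ : s ≠ t₀ := by
    rintro rfl
    omega
  obtain ⟨t, rfl⟩ : ∃ t, s = t + 1 := ⟨s - 1, by omega⟩
  have hbelow : ∀ u, t₀ ≤ u → u ≤ t → h u ≤ g := by
    intro u hu1 hu2
    have := hmin u (by omega)
    by_contra hgu
    exact this ⟨hu1, by omega, by omega⟩
  have ht : h t ≤ g := hbelow t (by omega) le_rfl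
  have hst := hstep t (by omega)
  rw [abs_le] at hst
  exact ⟨t, by omega, by omega, by omega, by omega, hbelow⟩

/-- **First down-crossing** (the mirror image of `exists_upcross`). [folklore] -/
private theorem exists_downcross {h : ℕ → ℤ} {k : ℕ} (hstep : ∀ t, t < k → |h (t + 1) - h t| ≤ 1)
    {t₀ s₁ : ℕ} {g : ℤ} (h01 : t₀ ≤ s₁) (hs₁ : s₁ ≤ k) (hhi : g + 1 ≤ h t₀) (hlo : h s₁ ≤ g) :
    ∃ t, t₀ ≤ t ∧ t < s₁ ∧ h t = g + 1 ∧ h (t + 1) = g ∧ ∀ u, t₀ ≤ u → u ≤ t → g + 1 ≤ h u := by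
  have hstep' : ∀ t, t < k → |(-h (t + 1)) - (-h t)| ≤ 1 := fun t ht => by
    rw [show -h (t + 1) - -h t = -(h (t + 1) - h t) by ring, abs_neg]; exact hstep t ht
  obtain ⟨t, h1, h2, h3, h4, h5⟩ := exists_upcross (h := fun t => -h t) (g := -(g + 1)) hstep' h01 hs₁
    (by omega) (by omega)
  refine ⟨t, h1, h2, by omega, by omega, fun u hu1 hu2 => ?_⟩
  have := h5 u hu1 hu2
  omega

/-! ### The three-crossings lemma -/

open Classical in
/-- **Three-crossings lemma (Madras–Slade p. 94, remark after Theorem 4.2.4 — stated without proof; proved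
here).** Every irreducible `k`-step bridge `ω` on `ℤ^d` with span `A = ω₁(k)` satisfies `3A ≤ k + 2`: the level
gap `{0,1}` is crossed once and every internal gap `{g, g+1}`, `1 ≤ g ≤ A-1`, at least three times (a gap crossed
only upward once would make that time a renewal time), at pairwise distinct times `< k`.
[cite: MadrasSlade1993, §4.2, remark after Theorem 4.2.4 (p. 94)] -/
theorem three_mul_span_le {d : ℕ} [NeZero d] {k : ℕ} {ω : ℕ → Site d}
    (hω : ω ∈ irreducibleBridges d k) : 3 * (ω k 0).toNat ≤ k + 2 := by
  obtain ⟨hb, hk1, hbr, hirr⟩ := mem_irreducibleBridges.1 hω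
  obtain ⟨hωs, -⟩ := mem_bridges.1 hb
  obtain ⟨hω0, -, hadj, -⟩ := mem_saws.1 hωs
  -- heights
  set h : ℕ → ℤ := fun t => ω t 0 with hh
  have h0 : h 0 = 0 := by simp only [hh, hω0]; rfl
  have hstep : ∀ t, t < k → |h (t + 1) - h t| ≤ 1 := fun t ht => abs_sub_le_one_of_adj (hadj t ht) 0
  have hpos : ∀ i, 1 ≤ i → i ≤ k → 0 < h i ∧ h i ≤ h k := fun i hi1 hi2 => by
    have := hbr i hi1 hi2
    rw [hω0] at this
    exact this
  set A : ℤ := h k with hA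
  have hA1 : 1 ≤ A := by have := (hpos k hk1 le_rfl).1; omega
  -- crossing times of the gap `{g, g+1}`
  set C : ℤ → Finset ℕ := fun g => (range k).filter fun t =>
    (h t = g ∧ h (t + 1) = g + 1) ∨ (h t = g + 1 ∧ h (t + 1) = g) with hC
  have hmemC : ∀ {g : ℤ} {t : ℕ}, t ∈ C g ↔ t < k ∧ ((h t = g ∧ h (t + 1) = g + 1) ∨ (h t = g + 1 ∧ h (t + 1) = g)) := by
    intro g t
    simp only [hC, Finset.mem_filter, Finset.mem_range]
  have hdisj : ∀ g g' : ℤ, g ≠ g' → Disjoint (C g) (C g') := by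
    intro g g' hne
    rw [Finset.disjoint_left]
    intro t ht ht'
    rw [hmemC] at ht ht'
    omega
  -- gap `0` is crossed at time `0`
  have hC0 : 1 ≤ (C 0).card := by
    have h1 : h 1 = 1 := by
      have := (hpos 1 le_rfl hk1).1
      have hs := hstep 0 hk1
      rw [zero_add, abs_le] at hs
      omega
    have : 0 ∈ C 0 := by rw [hmemC]; exact ⟨hk1, Or.inl ⟨h0, by rw [h1]; norm_num⟩⟩
    exact Finset.card_pos.2 ⟨0, this⟩
  -- internal gaps are crossed at least three times
  have hC3 : ∀ g : ℤ, 1 ≤ g → g + 1 ≤ A → 3 ≤ (C g).card := by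
    intro g hg1 hgA
    -- first up-crossing
    obtain ⟨t₁, -, ht₁k, ht₁g, ht₁g1, hbelow⟩ :=
      exists_upcross (g := g) (t₀ := 0) (s₁ := k) hstep (Nat.zero_le k) le_rfl (by rw [h0]; omega) hgA
    have ht₁1 : 1 ≤ t₁ := by
      by_contra h00
      have : t₁ = 0 := by omega
      rw [this, h0] at ht₁g
      omega
    -- the walk must come back to height `≤ g` after `t₁`, else `t₁` is a renewal time
    have hback : ∃ s, t₁ + 1 ≤ s ∧ s ≤ k ∧ h s ≤ g := by
      by_contra hno
      simp only [not_exists, not_and, not_le] at hno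
      refine hirr t₁ ht₁1 (by omega) ⟨ht₁k.le, ?_, ?_⟩
      · intro i hi1 hi2
        refine ⟨(hpos i hi1 (by omega)).1 |> fun h' => by rw [hω0]; exact h', ?_⟩
        show h i ≤ h t₁
        rw [ht₁g]; exact hbelow i (Nat.zero_le i) hi2
      · intro j hj1 hj2
        refine ⟨?_, ?_⟩
        · show h (t₁ + 0) < h (t₁ + j)
          rw [add_zero, ht₁g]
          have := hno (t₁ + j) (by omega) (by omega)
          omega
        · show h (t₁ + j) ≤ h (t₁ + (k - t₁))
          rw [show t₁ + (k - t₁) = k by omega]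
          exact (hpos (t₁ + j) (by omega) (by omega)).2
    obtain ⟨s, hs1, hsk, hsg⟩ := hback
    -- a down-crossing `t_d ∈ [t₁+1, s)` and a further up-crossing `t₂ ∈ [t_d+1, k)`
    obtain ⟨td, htd1, htds, htdg1, htdg, -⟩ :=
      exists_downcross (g := g) (t₀ := t₁ + 1) (s₁ := s) hstep hs1 hsk (by rw [ht₁g1]) hsg
    obtain ⟨t₂, ht₂1, ht₂k, ht₂g, ht₂g1, -⟩ :=
      exists_upcross (g := g) (t₀ := td + 1) (s₁ := k) hstep (show td + 1 ≤ k by omega) le_rfl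
        (by rw [htdg]) hgA
    have hsub : ({t₁, td, t₂} : Finset ℕ) ⊆ C g := by
      intro t ht
      simp only [Finset.mem_insert, Finset.mem_singleton] at ht
      rw [hmemC]
      rcases ht with rfl | rfl | rfl
      · exact ⟨ht₁k, Or.inl ⟨ht₁g, ht₁g1⟩⟩
      · exact ⟨by omega, Or.inr ⟨htdg1, htdg⟩⟩
      · exact ⟨ht₂k, Or.inl ⟨ht₂g, ht₂g1⟩⟩
    have hcard : ({t₁, td, t₂} : Finset ℕ).card = 3 := by
      rw [Finset.card_eq_three]
      exact ⟨t₁, td, t₂, by omega, by omega, by omega, rfl⟩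
    calc 3 = ({t₁, td, t₂} : Finset ℕ).card := hcard.symm
      _ ≤ (C g).card := Finset.card_le_card hsub
  -- count: distinct gaps are crossed at distinct times `< k`
  obtain ⟨M, hM⟩ : ∃ M : ℕ, A.toNat = M + 1 := ⟨A.toNat - 1, by omega⟩
  have hU : ((range (M + 1)).biUnion fun i : ℕ => C (i : ℤ)) ⊆ range k := by
    intro t ht
    obtain ⟨i, -, hi⟩ := Finset.mem_biUnion.1 ht
    rw [hmemC] at hi
    exact Finset.mem_range.2 hi.1
  have hsum : ∑ i ∈ range (M + 1), (C (i : ℤ)).card ≤ k := by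
    rw [← Finset.card_biUnion]
    · simpa using Finset.card_le_card hU
    · intro i _ j _ hij
      exact hdisj _ _ (by exact_mod_cast hij)
  have hlow : 1 + 3 * M ≤ ∑ i ∈ range (M + 1), (C (i : ℤ)).card := by
    rw [Finset.sum_range_succ']
    have h3 : 3 * M ≤ ∑ i ∈ range M, (C ((i + 1 : ℕ) : ℤ)).card := by
      calc 3 * M = ∑ i ∈ range M, 3 := by simp [mul_comm]
        _ ≤ ∑ i ∈ range M, (C ((i + 1 : ℕ) : ℤ)).card :=
            Finset.sum_le_sum fun i hi => by
              have hi' := Finset.mem_range.1 hi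
              exact hC3 _ (by push_cast; omega) (by push_cast; omega)
    have h1 : 1 ≤ (C ((0 : ℕ) : ℤ)).card := by simpa using hC0
    omega
  have hM' : (ω k 0).toNat = M + 1 := hM
  rw [hM']
  omega

/-- `ℤ` form of the three-crossings lemma: `3 · ω₁(k) ≤ k + 2` for every irreducible `k`-step bridge.
[cite: MadrasSlade1993, §4.2, remark after Theorem 4.2.4 (p. 94)] -/
theorem three_mul_span_le_int {d : ℕ} [NeZero d] {k : ℕ} {ω : ℕ → Site d}
    (hω : ω ∈ irreducibleBridges d k) : 3 * ω k 0 ≤ (k : ℤ) + 2 := by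
  have h := three_mul_span_le hω
  obtain ⟨hb, hk1, hbr, -⟩ := mem_irreducibleBridges.1 hω
  have h0 : 0 ≤ ω k 0 := by
    have := (hbr k hk1 le_rfl).1
    have h00 : ω 0 = 0 := (mem_saws.1 (mem_bridges.1 hb).1).1
    rw [h00] at this
    exact le_of_lt this
  have hc : ((ω k 0).toNat : ℤ) = ω k 0 := Int.toNat_of_nonneg h0
  have h' : (3 : ℤ) * ((ω k 0).toNat : ℤ) ≤ (k : ℤ) + 2 := by exact_mod_cast h
  rwa [hc] at h'

end Literature.Probability.RandomPlanarGeometry.SAW.Zd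

end
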